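import Literature.NumberTheory.LFunctions.SoundararajanContour
import HarnessLib

/-!
# Soundararajan's contour: dyadic evaluation of the block sums (Balazard–de Roton 2008, Props. 22, 24)

Topic `Literature/NumberTheory/LFunctions`; a brick of the reduction of
`Literature.NumberTheory.LFunctions.BalazardDeRoton2010_thm1` to the engine statements of
Soundararajan's method. With the parameters of M. Balazard, A. de Roton, arXiv:0810.3587 §8.2 /
arXiv:0812.1689 §6.2 as functions of `N`,

`κ = ⌊(log N)^{1/2}(log log N)^{5/2}⌋`, `K = ⌊log N/log 2⌋`, `N₀ = 2^κ`, `T = N₁ = 2^K`,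

this file evaluates the right-hand side of `SoundContour.norm_perron_integral_le` for `N` large:
the dyadic decomposition `Σ_{N₀ ≤ n < T} = Σ_{κ ≤ k < K} Σ_{2^k ≤ n < 2^{k+1}}` and the block
estimate `TypicalLevelSets.sum_exp_blockExp_ladder_le` (Prop. 24 with Prop. 23) give
`Σ_{N₀ ≤ n < T} e^{E_n}/(n+1) ≤ exp((log N)^{1/2}(log log N)^{5/2+6δ})` ("`B_N ≪_δ exp((log N)^{1/2}
(log log N)^{5−c+6δ})`" with `c = 5/2`), and the first segment and the ends contribute at most the
same and `√x` respectively (§8.3). All "N assez grand" conditions are collected in the predicate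
`SoundContour.LargeN` and shown to hold eventually (`SoundContour.eventually_largeN`).

## References

* [BalazardRoton2008] M. Balazard, A. de Roton, arXiv:0810.3587, §8.2–8.5 (Props. 22–24).
* [BalazardDeRoton2010] M. Balazard, A. de Roton, arXiv:0812.1689, §6.2.
-/

noncomputable section

open Complex Real Set MeasureTheory intervalIntegral Finset Filter Topology
open scoped Interval

namespace Literature.NumberTheory.LFunctions

namespace SoundContour

open Soundararajan TypicalLadder TypicalPointwise TypicalLevelSets TypicalCounting MertensBoundRH

/-! ### The parameters as functions of `N` -/

/-- `y(N) = (log N)^{1/2}(log log N)^{5/2}`. [cite: BalazardDeRoton2010, §6.2] -/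
def yPar (N : ℕ) : ℝ := Real.log N ^ (1 / 2 : ℝ) * Real.log (Real.log N) ^ (5 / 2 : ℝ)

/-- `κ(N) = ⌊(log N)^{1/2}(log log N)^{5/2}⌋`. [cite: BalazardDeRoton2010, §6.2] -/
def kap (N : ℕ) : ℕ := ⌊yPar N⌋₊

/-- `K(N) = ⌊log N/log 2⌋`. [cite: BalazardDeRoton2010, §6.2] -/
def bigK (N : ℕ) : ℕ := Nat.log 2 N

/-- `N₀ = 2^κ`. [cite: BalazardDeRoton2010, §6.2] -/
def nzero (N : ℕ) : ℕ := 2 ^ kap N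

/-- `T = N₁ = 2^K`. [cite: BalazardDeRoton2010, §6.2] -/
def bigT (N : ℕ) : ℕ := 2 ^ bigK N

/-- `Λ_p(N) = (log N)^{1/2}(log log N)^p` (the exponent `eExp p N` of the rate files).
[cite: BalazardDeRoton2010, Prop. 12] -/
def lam (p : ℝ) (N : ℕ) : ℝ := Real.log N ^ (1 / 2 : ℝ) * Real.log (Real.log N) ^ p

/-! ### Dyadic decomposition -/

/-- `Σ_{2^κ ≤ n < 2^K} g(n) = Σ_{κ ≤ k < K} Σ_{2^k ≤ n < 2^{k+1}} g(n)`. [folklore] -/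
lemma sum_Ico_two_pow (g : ℕ → ℝ) {κ K : ℕ} (hκK : κ ≤ K) :
    ∑ n ∈ Finset.Ico (2 ^ κ) (2 ^ K), g n =
      ∑ k ∈ Finset.Ico κ K, ∑ n ∈ Finset.Ico (2 ^ k) (2 ^ (k + 1)), g n := by
  induction K, hκK using Nat.le_induction with
  | base => simp
  | succ K hK ih =>
    rw [Finset.sum_Ico_succ_top hK, ← ih, Finset.sum_Ico_consecutive]
    · exact Nat.pow_le_pow_right two_pos hK
    · exact Nat.pow_le_pow_right two_pos (Nat.le_succ K)

/-- On the block `2^k ≤ n < 2^{k+1}`: `bbase n = 2^k`. [folklore] -/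
lemma bbase_eq_of_mem {k n : ℕ} (hn : n ∈ Finset.Ico (2 ^ k) (2 ^ (k + 1))) : bbase n = 2 ^ k := by
  rw [Finset.mem_Ico] at hn
  rw [bbase, Nat.log_eq_of_pow_le_of_lt_pow hn.1 hn.2]

/-- Largeness of a block size for the counting step (thresholds of Prop. 20 and of
`TypicalLevelSets.sum_exp_blockExp_ladder_le`). [folklore] -/
def GoodCount (δ D₂₀ T₂₀ t : ℝ) : Prop :=
  T₂₀ ≤ t ∧ 4 ≤ Real.log (Real.log t) ∧ 4 / δ ^ 2 + (2 + |D₂₀|) / δ ≤ Real.log (Real.log t) ^ 2 ∧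
    Real.exp (16384 + |D₂₀|) ≤ Real.log (Real.log t)

/-- **One dyadic block.** For `k` with `2^k` good (sizes and counting), `2^{k+1} ≤ T ≤ x`:
`Σ_{2^k ≤ n < 2^{k+1}} e^{E_n}/(n+1) ≤ e^{blockExp δ D₂ A'_k (2ℓ₂²+2)} + 2C(log 2^k/ℓ₂ + 1) e^{2^{4+4δ} e^{A_k} A_k^{4+4δ}}`
with `A'_k = log(log x/log 2^k)`, `ℓ₂ = log log 2^k`, `A_k = A'_k + log ℓ₂ + D₂₀ + D₂δ⁻²`
(`D₂ = max D 0 + 2`). [cite: BalazardRoton2008, §8.4] -/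
theorem block_sum_le {δ D C D₂₀ T₁ T₁₈ T₂₀ x : ℝ} (hδ0 : 0 < δ) (hδ1 : δ ≤ 1) (hD : 0 ≤ D)
    (h18 : Prop18With δ T₁₈) (h20 : Prop20With δ C D₂₀ T₂₀) (hC : 0 ≤ C) {k : ℕ}
    (hg : GoodSize T₁ T₁₈ ((2 ^ k : ℕ) : ℝ)) (hgc : GoodCount δ D₂₀ T₂₀ ((2 ^ k : ℕ) : ℝ))
    (hkx : ((2 ^ (k + 1) : ℕ) : ℝ) ≤ x) :
    ∑ n ∈ Finset.Ico (2 ^ k) (2 ^ (k + 1)), Real.exp (blockE δ (max D 0 + 2) (Real.log x) n) / ((n : ℝ) + 1) ≤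
      Real.exp (blockExp δ (max D 0 + 2) (Real.log (Real.log x / Real.log ((2 ^ k : ℕ) : ℝ)))
          (2 * Real.log (Real.log ((2 ^ k : ℕ) : ℝ)) ^ 2 + 2)) +
        2 * C * (Real.log ((2 ^ k : ℕ) : ℝ) / Real.log (Real.log ((2 ^ k : ℕ) : ℝ)) + 1) *
          Real.exp ((2 : ℝ) ^ (4 + 4 * δ) *
            Real.exp (Real.log (Real.log x / Real.log ((2 ^ k : ℕ) : ℝ)) +
              Real.log (Real.log (Real.log ((2 ^ k : ℕ) : ℝ))) + D₂₀ + (max D 0 + 2) * δ⁻¹ ^ 2) *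
            (Real.log (Real.log x / Real.log ((2 ^ k : ℕ) : ℝ)) +
              Real.log (Real.log (Real.log ((2 ^ k : ℕ) : ℝ))) + D₂₀ + (max D 0 + 2) * δ⁻¹ ^ 2) ^ (4 + 4 * δ)) := by
  set B : ℕ := 2 ^ k with hB
  set L := Real.log x with hL
  set A' := Real.log (L / Real.log (B : ℝ)) with hA'
  obtain ⟨-, hT₁₈, hTe, hbase, ha, hb⟩ := hg
  obtain ⟨hT₂₀, hℓ4, hℓδ, hℓA⟩ := hgc
  obtain ⟨hL2, hLT, hB0, hB1, h7⟩ := size_facts hTe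
  have hBx : (B : ℝ) ≤ x := by
    have : (B : ℝ) ≤ ((2 ^ (k + 1) : ℕ) : ℝ) := by
      rw [hB]; exact_mod_cast Nat.pow_le_pow_right two_pos (Nat.le_succ k)
    exact this.trans hkx
  have hlogBx : Real.log (B : ℝ) ≤ L := Real.log_le_log hB0 hBx
  have hA'0 : 0 ≤ A' := Real.log_nonneg ((one_le_div (by linarith)).2 hlogBx)
  have hD₂ : 0 ≤ max D 0 + 2 := by positivity
  -- admissible integers exist on the whole block (Prop. 18)
  have hex : ∀ n ∈ Finset.Ico B (2 * B), ∃ W : ℕ, Admissible δ (B : ℝ) n W := by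
    intro n hn
    rw [Finset.mem_Ico] at hn
    refine ⟨vStar (B : ℝ), admissible_vStar h18 hT₁₈ (by linarith) (by linarith) hbase ha hb ?_ ?_⟩
    · exact_mod_cast hn.1
    · have : n + 1 ≤ 2 * B := hn.2
      exact_mod_cast this
  have hmain := sum_exp_blockExp_ladder_le (A' := A') h20 hC hδ0 hδ1 hD₂ hA'0 hT₂₀ hex hℓ4 hℓδ hℓA
  -- compare term by term: `bbase n = B`, `1/(n+1) ≤ 1/B`
  have h2B : 2 ^ (k + 1) = 2 * B := by rw [hB, pow_succ]; ring
  have hterm : ∀ n ∈ Finset.Ico (2 ^ k) (2 ^ (k + 1)),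
      Real.exp (blockE δ (max D 0 + 2) L n) / ((n : ℝ) + 1) ≤
        (B : ℝ)⁻¹ * Real.exp (blockExp δ (max D 0 + 2) A' (ladder δ (B : ℝ) n)) := by
    intro n hn
    have hbb := bbase_eq_of_mem hn
    rw [Finset.mem_Ico] at hn
    have hn1 : (B : ℝ) ≤ (n : ℝ) + 1 := by
      have : B ≤ n := hn.1
      have : (B : ℝ) ≤ n := by exact_mod_cast this
      linarith
    have hE : blockE δ (max D 0 + 2) L n = blockExp δ (max D 0 + 2) A' (ladder δ (B : ℝ) n) := by
      simp only [blockE, lad, hbb, hA', hB]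
    rw [hE, div_eq_mul_inv, mul_comm]
    refine mul_le_mul_of_nonneg_right ?_ (Real.exp_pos _).le
    exact inv_anti₀ hB0 hn1
  calc ∑ n ∈ Finset.Ico (2 ^ k) (2 ^ (k + 1)), Real.exp (blockE δ (max D 0 + 2) L n) / ((n : ℝ) + 1)
      ≤ ∑ n ∈ Finset.Ico (2 ^ k) (2 ^ (k + 1)),
          (B : ℝ)⁻¹ * Real.exp (blockExp δ (max D 0 + 2) A' (ladder δ (B : ℝ) n)) :=
        Finset.sum_le_sum hterm
    _ = (B : ℝ)⁻¹ * ∑ n ∈ Finset.Ico B (2 * B),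
          Real.exp (blockExp δ (max D 0 + 2) A' (ladder δ (B : ℝ) n)) := by
        rw [← Finset.mul_sum, h2B]
    _ ≤ (B : ℝ)⁻¹ * ((B : ℝ) * (Real.exp (blockExp δ (max D 0 + 2) A' (2 * Real.log (Real.log (B : ℝ)) ^ 2 + 2)) +
          2 * C * (Real.log (B : ℝ) / Real.log (Real.log (B : ℝ)) + 1) *
            Real.exp ((2 : ℝ) ^ (4 + 4 * δ) *
              Real.exp (A' + Real.log (Real.log (Real.log (B : ℝ))) + D₂₀ + (max D 0 + 2) * δ⁻¹ ^ 2) *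
              (A' + Real.log (Real.log (Real.log (B : ℝ))) + D₂₀ + (max D 0 + 2) * δ⁻¹ ^ 2) ^ (4 + 4 * δ)))) :=
        mul_le_mul_of_nonneg_left hmain (inv_nonneg.2 hB0.le)
    _ = _ := by rw [← mul_assoc, inv_mul_cancel₀ hB0.ne', one_mul]

/-! ### "`N` assez grand" -/

/-- The finitely many largeness conditions on `N` used in the evaluation (all hold for `N` large,
`eventually_largeN`); `u = log N`, `v = log log N`, `y = u^{1/2}v^{5/2}`; `tthr` is the maximum of
the size thresholds. [folklore] -/
structure LargeN (δ D C D₂₀ Ca : ℝ) (M : ℕ) (tthr : ℝ) (N : ℕ) : Prop where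
  Nbig : 2 ^ 32 ≤ N
  y2 : 2 ≤ yPar N
  yu : yPar N + 1 ≤ Real.log N
  ythr : tthr ≤ yPar N
  v6 : 6 ≤ Real.log (Real.log N)
  c1 : Real.log (Real.log (Real.log N)) + |D₂₀| + (D + 2) * δ⁻¹ ^ 2 ≤ Real.log (Real.log N)
  c2 : (2 : ℝ) ^ 20 * Real.exp (D₂₀ + (D + 2) * δ⁻¹ ^ 2) ≤ Real.log (Real.log N) ^ (2 * δ)
  c3 : 224 * Real.log (Real.log N) ^ 3 ≤ Real.log N ^ (1 / 2 : ℝ)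
  c4 : 2 * Real.log N * (1 + 2 * C * Real.log N) ≤ Real.exp (Real.log N ^ (1 / 2 : ℝ) / 2)
  c5 : Ca * (2 * Real.log N) ^ M ≤ Real.exp (Real.log N ^ (1 / 2 : ℝ))
  c6 : 33 ≤ Real.log (Real.log N) ^ (6 * δ)
  c7 : Real.log 4 + (D + 2) * δ⁻¹ ^ 2 ≤ 2 * Real.log (Real.log (Real.log N))
  c8 : 320 * Real.log (Real.log (Real.log N)) ≤ Real.log (Real.log N)
  c9 : 32 * D * δ⁻¹ ≤ Real.log (Real.log N)

section eval

variable {δ D C D₂₀ Ca tthr : ℝ} {M N : ℕ}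

/-- Basic consequences of `LargeN`: `u = log N ≥ 22`, `1 ≤ κ < K`, `κ ≤ y`, `y/4 ≤ κ log 2`,
`K log 2 ≤ u`, `u − 2 ≤ (K−1) log 2`, `T ≤ N < 2T`. [folklore] -/
lemma params (h : LargeN δ D C D₂₀ Ca M tthr N) :
    22 ≤ Real.log N ∧ 1 ≤ kap N ∧ kap N < bigK N ∧ (kap N : ℝ) ≤ yPar N ∧
      yPar N / 4 ≤ kap N * Real.log 2 ∧ (bigK N : ℝ) * Real.log 2 ≤ Real.log N ∧
      Real.log N - 2 ≤ ((bigK N : ℝ) - 1) * Real.log 2 ∧ bigT N ≤ N ∧ N < 2 * bigT N ∧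
      (0 : ℝ) < N := by
  have hN16 : (2 : ℝ) ^ 32 ≤ N := by exact_mod_cast h.Nbig
  have hN0 : (0 : ℝ) < N := by linarith
  have hNn0 : N ≠ 0 := by intro h0; rw [h0] at hN0; simp at hN0
  have hlog2 := Real.log_two_gt_d9
  have hlog2' := Real.log_two_lt_d9
  have hu : 22 ≤ Real.log N := by
    have : Real.log ((2 : ℝ) ^ 32) ≤ Real.log N := Real.log_le_log (by positivity) hN16
    rw [Real.log_pow] at this; push_cast at this; linarith
  have hy0 : 0 ≤ yPar N := by
    unfold yPar
    exact mul_nonneg (Real.rpow_nonneg (Real.log_natCast_nonneg N) _)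
      (Real.rpow_nonneg (Real.log_nonneg (by linarith)) _)
  have hκy : (kap N : ℝ) ≤ yPar N := Nat.floor_le hy0
  have hκ1 : 1 ≤ kap N := Nat.le_floor (by simpa using (show (1 : ℝ) ≤ yPar N by linarith [h.y2]))
  have hyκ : yPar N / 4 ≤ kap N * Real.log 2 := by
    have h1 : yPar N < kap N + 1 := Nat.lt_floor_add_one _
    have : yPar N / 2 ≤ kap N := by linarith [h.y2]
    nlinarith
  -- `κ < K` from `2^{κ+1} ≤ N`
  have hpow : 2 ^ (kap N + 1) ≤ N := by
    have h1 : ((kap N : ℝ) + 1) * Real.log 2 ≤ Real.log N := by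
      have := h.yu; nlinarith
    have h2 : Real.log ((2 : ℝ) ^ (kap N + 1)) ≤ Real.log N := by
      rw [Real.log_pow]; push_cast; exact h1
    have h3 : (2 : ℝ) ^ (kap N + 1) ≤ N := (Real.log_le_log_iff (by positivity) hN0).1 h2
    exact_mod_cast h3
  have hκK : kap N < bigK N := by
    have := Nat.le_log_of_pow_le one_lt_two hpow
    rw [bigK]; omega
  have hKu : (bigK N : ℝ) * Real.log 2 ≤ Real.log N := by
    have h1 : ((2 ^ bigK N : ℕ) : ℝ) ≤ N := by exact_mod_cast Nat.pow_log_le_self 2 hNn0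
    have h2 := Real.log_le_log (by positivity) h1
    push_cast at h2; rwa [Real.log_pow] at h2
  have hKl : Real.log N - 2 ≤ ((bigK N : ℝ) - 1) * Real.log 2 := by
    have h1 : (N : ℝ) < ((2 ^ (bigK N + 1) : ℕ) : ℝ) := by
      exact_mod_cast Nat.lt_pow_succ_log_self one_lt_two N
    have h2 := Real.log_lt_log hN0 h1
    push_cast at h2; rw [Real.log_pow] at h2; push_cast at h2
    nlinarith
  have hTN : bigT N ≤ N := Nat.pow_log_le_self 2 hNn0
  have hNT : N < 2 * bigT N := by
    have := Nat.lt_pow_succ_log_self one_lt_two N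
    rw [bigT, bigK, show 2 * 2 ^ Nat.log 2 N = 2 ^ (Nat.log 2 N).succ by rw [pow_succ]; ring]
    exact this
  exact ⟨hu, hκ1, hκK, hκy, hyκ, hKu, hKl, hTN, hNT, hN0⟩

/-- `log(N + ½)` versus `log N`: `log N ≤ log(N+½) ≤ log N + 1`. [folklore] -/
lemma log_x_bounds {N : ℕ} (hN : (1 : ℝ) ≤ N) :
    Real.log N ≤ Real.log ((N : ℝ) + 1 / 2) ∧ Real.log ((N : ℝ) + 1 / 2) ≤ Real.log N + 1 := by
  have hN0 : (0 : ℝ) < N := by linarith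
  refine ⟨Real.log_le_log hN0 (by linarith), ?_⟩
  have h1 : Real.log ((N : ℝ) + 1 / 2) ≤ Real.log (2 * N) := Real.log_le_log (by linarith) (by linarith)
  rw [Real.log_mul two_ne_zero hN0.ne'] at h1
  have := Real.log_two_lt_d9; linarith

set_option maxHeartbeats 400000 in
/-- **The block bracket is `≤ (1 + 2C log N)·exp(Λ/2)`** for `κ ≤ k < K` under `LargeN`
(the computation of §8.4: `A = log(log N (log log T)/log T) + O(1)`, `C = 4+5δ`,
`e^A A^C ≪ (log N)^{1/2}(log log N)^{5/2+5δ}`). [cite: BalazardRoton2008, §8.4] -/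
lemma bracket_le (hδ0 : 0 < δ) (hδ1 : δ ≤ 1) (hD : 0 ≤ D) (hC : 0 ≤ C)
    (h : LargeN δ D C D₂₀ Ca M tthr N) {k : ℕ} (hk1 : kap N ≤ k) (hk2 : k < bigK N)
    (hℓ4 : 4 ≤ Real.log (Real.log ((2 ^ k : ℕ) : ℝ)))
    (hℓA : Real.exp (16384 + |D₂₀|) ≤ Real.log (Real.log ((2 ^ k : ℕ) : ℝ))) :
    Real.exp (blockExp δ (max D 0 + 2) (Real.log (Real.log ((N : ℝ) + 1 / 2) / Real.log ((2 ^ k : ℕ) : ℝ)))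
          (2 * Real.log (Real.log ((2 ^ k : ℕ) : ℝ)) ^ 2 + 2)) +
        2 * C * (Real.log ((2 ^ k : ℕ) : ℝ) / Real.log (Real.log ((2 ^ k : ℕ) : ℝ)) + 1) *
          Real.exp ((2 : ℝ) ^ (4 + 4 * δ) *
            Real.exp (Real.log (Real.log ((N : ℝ) + 1 / 2) / Real.log ((2 ^ k : ℕ) : ℝ)) +
              Real.log (Real.log (Real.log ((2 ^ k : ℕ) : ℝ))) + D₂₀ + (max D 0 + 2) * δ⁻¹ ^ 2) *
            (Real.log (Real.log ((N : ℝ) + 1 / 2) / Real.log ((2 ^ k : ℕ) : ℝ)) +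
              Real.log (Real.log (Real.log ((2 ^ k : ℕ) : ℝ))) + D₂₀ + (max D 0 + 2) * δ⁻¹ ^ 2) ^ (4 + 4 * δ)) ≤
      (1 + 2 * C * Real.log N) * Real.exp (lam (5 / 2 + 6 * δ) N / 2) := by
  obtain ⟨hu22, hκ1, hκK, hκy, hyκ, hKu, hKl, hTN, hNT, hN0⟩ := params h
  have hmax : max D 0 = D := max_eq_left hD
  rw [hmax]
  -- notation
  set u := Real.log N with hu
  set v := Real.log u with hv
  set s := u ^ (1 / 2 : ℝ) with hs
  set logB := Real.log ((2 ^ k : ℕ) : ℝ) with hlogB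
  set ℓ₂ := Real.log logB with hℓ₂
  set L := Real.log ((N : ℝ) + 1 / 2) with hL
  set A' := Real.log (L / logB) with hA'
  set c₀ := D₂₀ + (D + 2) * δ⁻¹ ^ 2 with hc₀
  set A := A' + Real.log ℓ₂ + D₂₀ + (D + 2) * δ⁻¹ ^ 2 with hA
  have hlog2 := Real.log_two_gt_d9
  have hu0 : 0 < u := by linarith
  have hv6 : 6 ≤ v := h.v6
  have hv0 : 0 < v := by linarith
  have hv1 : 1 ≤ v := by linarith
  have hs0 : 0 < s := Real.rpow_pos_of_pos hu0 _
  have hss : s * s = u := by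
    rw [hs, ← Real.rpow_add hu0]; norm_num
  have hs3 : 3 ≤ s := by nlinarith [hss, hs0.le]
  -- (f1) `y/4 ≤ log B ≤ u`
  have hlogBk : logB = k * Real.log 2 := by
    rw [hlogB]; push_cast; rw [Real.log_pow]
  have hlogB_lo : yPar N / 4 ≤ logB := by
    rw [hlogBk]
    have : (kap N : ℝ) ≤ k := by exact_mod_cast hk1
    have := mul_le_mul_of_nonneg_right this (Real.log_nonneg one_le_two)
    linarith
  have hlogB_hi : logB ≤ u := by
    rw [hlogBk]
    have : (k : ℝ) ≤ bigK N := by exact_mod_cast hk2.le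
    have := mul_le_mul_of_nonneg_right this (Real.log_nonneg one_le_two)
    linarith
  have hy2 : 2 ≤ yPar N := h.y2
  have hy0 : 0 ≤ yPar N := by linarith
  have hlogB0 : 0 < logB := by linarith
  -- (f2) `u ≤ L ≤ 2u`
  obtain ⟨hLu, hLu1⟩ := log_x_bounds (N := N) (by linarith [show (22 : ℝ) ≤ u from hu22, Real.log_le_sub_one_of_pos hN0])
  have hL2u : L ≤ 2 * u := by linarith
  -- (f3) `ℓ₂ ≤ v`
  have hℓ₂v : ℓ₂ ≤ v := Real.log_le_log hlogB0 hlogB_hi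
  have hℓ₂0 : 0 < ℓ₂ := by linarith
  -- (f4) `0 ≤ A' ≤ v`
  have hA'0 : 0 ≤ A' := Real.log_nonneg ((one_le_div hlogB0).2 (hlogB_hi.trans hLu))
  have hyeq : yPar N = s * v ^ (5 / 2 : ℝ) := rfl
  have hv52 : 1 ≤ v ^ (5 / 2 : ℝ) := Real.one_le_rpow hv1 (by norm_num)
  have hy_s : s ≤ yPar N := by rw [hyeq]; exact le_mul_of_one_le_right hs0.le hv52
  have hlogB_s : s / 4 ≤ logB := by linarith
  have hA'v : A' ≤ v := by
    -- `L/log B ≤ 8 s` and `log(8 s) = log 8 + v/2 ≤ v`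
    have h1 : L / logB ≤ 8 * s := by
      rw [div_le_iff₀ hlogB0]
      have := mul_le_mul_of_nonneg_left hlogB_s (show 0 ≤ 8 * s by positivity)
      have e : 8 * s * (s / 4) = 2 * u := by rw [← hss]; ring
      linarith
    have h2 : A' ≤ Real.log (8 * s) := Real.log_le_log (div_pos (by linarith) hlogB0) h1
    have h3 : Real.log (8 * s) = Real.log 8 + v / 2 := by
      rw [Real.log_mul (by norm_num) hs0.ne', hs, Real.log_rpow hu0, ← hv]; ring
    have h8 : Real.log 8 < 3 := by
      have : Real.log 8 = 3 * Real.log 2 := by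
        rw [show (8 : ℝ) = 2 ^ 3 by norm_num, Real.log_pow]; norm_num
      have := Real.log_two_lt_d9; linarith
    linarith
  -- (f5), (f6) `0 ≤ A ≤ 2v`
  have hlogℓ₂ : Real.log ℓ₂ ≤ Real.log v := Real.log_le_log hℓ₂0 hℓ₂v
  have hlogℓ₂' : 16384 + |D₂₀| ≤ Real.log ℓ₂ := by
    rw [← Real.log_exp (16384 + |D₂₀|)]; exact Real.log_le_log (Real.exp_pos _) hℓA
  have hA0 : 0 ≤ A := by
    rw [hA]
    have : 0 ≤ (D + 2) * δ⁻¹ ^ 2 := by positivity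
    linarith [neg_abs_le D₂₀, abs_nonneg D₂₀]
  have hA2v : A ≤ 2 * v := by
    rw [hA]; have := h.c1; linarith [le_abs_self D₂₀]
  -- (f7) `exp A ≤ 8 e^{c₀} s / v^{3/2}`, written as `exp A * v^{3/2} ≤ 8 e^{c₀} s`
  have hexpA : Real.exp A = L / logB * ℓ₂ * Real.exp c₀ := by
    rw [hA, show A' + Real.log ℓ₂ + D₂₀ + (D + 2) * δ⁻¹ ^ 2 = A' + Real.log ℓ₂ + c₀ by rw [hc₀]; ring,
      Real.exp_add, Real.exp_add, hA', Real.exp_log (div_pos (by linarith) hlogB0), Real.exp_log hℓ₂0]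
  have hv32 : v ^ (3 / 2 : ℝ) * v = v ^ (5 / 2 : ℝ) := by
    rw [mul_comm, ← Real.rpow_one_add' hv0.le (by norm_num)]; norm_num
  have hexpA' : Real.exp A * v ^ (3 / 2 : ℝ) ≤ 8 * Real.exp c₀ * s := by
    rw [hexpA]
    -- `L/logB · ℓ₂ · v^{3/2} ≤ (8u/y)·v·v^{3/2} = 8 s`
    have h1 : L / logB ≤ 8 * u / yPar N := by
      rw [div_le_div_iff₀ hlogB0 (by linarith)]
      have a : 2 * u * yPar N ≤ 8 * u * logB := by
        have := mul_le_mul_of_nonneg_left hlogB_lo (show 0 ≤ 8 * u by positivity); linarith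
      have b : L * yPar N ≤ 2 * u * yPar N := mul_le_mul_of_nonneg_right hL2u hy0
      linarith
    have h2 : L / logB * ℓ₂ * v ^ (3 / 2 : ℝ) ≤ 8 * u / yPar N * v * v ^ (3 / 2 : ℝ) := by
      have a := mul_le_mul h1 hℓ₂v hℓ₂0.le (by positivity)
      exact mul_le_mul_of_nonneg_right a (by positivity)
    have h3 : 8 * u / yPar N * v * v ^ (3 / 2 : ℝ) = 8 * s := by
      have e1 : 8 * u / yPar N * v * v ^ (3 / 2 : ℝ) = 8 * u / yPar N * (v ^ (3 / 2 : ℝ) * v) := by ring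
      rw [e1, hv32, hyeq, ← hss, div_mul_eq_mul_div, div_eq_iff (ne_of_gt (by positivity))]
      ring
    calc L / logB * ℓ₂ * Real.exp c₀ * v ^ (3 / 2 : ℝ)
        = (L / logB * ℓ₂ * v ^ (3 / 2 : ℝ)) * Real.exp c₀ := by ring
      _ ≤ (8 * u / yPar N * v * v ^ (3 / 2 : ℝ)) * Real.exp c₀ :=
          mul_le_mul_of_nonneg_right h2 (Real.exp_pos _).le
      _ = 8 * Real.exp c₀ * s := by rw [h3]; ring
  -- (f8) `Φ ≤ Λ/2`
  have hΛ : lam (5 / 2 + 6 * δ) N = s * v ^ (5 / 2 + 6 * δ) := rfl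
  have hvpos : ∀ r : ℝ, 0 < v ^ r := fun r ↦ Real.rpow_pos_of_pos hv0 r
  have hΦ : (2 : ℝ) ^ (4 + 4 * δ) * Real.exp A * A ^ (4 + 4 * δ) ≤ lam (5 / 2 + 6 * δ) N / 2 := by
    have h2pow : (2 : ℝ) ^ (4 + 4 * δ) ≤ 2 ^ 8 := by
      have : (2 : ℝ) ^ (4 + 4 * δ) ≤ (2 : ℝ) ^ ((8 : ℕ) : ℝ) :=
        Real.rpow_le_rpow_of_exponent_le (by norm_num) (by push_cast; linarith)
      rwa [Real.rpow_natCast] at this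
    have hApow : A ^ (4 + 4 * δ) ≤ (2 : ℝ) ^ 8 * v ^ (4 + 4 * δ) := by
      calc A ^ (4 + 4 * δ) ≤ (2 * v) ^ (4 + 4 * δ) := Real.rpow_le_rpow hA0 hA2v (by positivity)
        _ = (2 : ℝ) ^ (4 + 4 * δ) * v ^ (4 + 4 * δ) := Real.mul_rpow (by norm_num) hv0.le
        _ ≤ (2 : ℝ) ^ 8 * v ^ (4 + 4 * δ) := mul_le_mul_of_nonneg_right h2pow (hvpos _).le
    have hsplit : v ^ (4 + 4 * δ) = v ^ (3 / 2 : ℝ) * v ^ (5 / 2 + 4 * δ) := by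
      rw [← Real.rpow_add hv0]; congr 1; ring
    have hsplit' : v ^ (2 * δ) * v ^ (5 / 2 + 4 * δ) = v ^ (5 / 2 + 6 * δ) := by
      rw [← Real.rpow_add hv0]; ring_nf
    have hexp0 : 0 ≤ Real.exp A := (Real.exp_pos A).le
    calc (2 : ℝ) ^ (4 + 4 * δ) * Real.exp A * A ^ (4 + 4 * δ)
        ≤ (2 : ℝ) ^ 8 * Real.exp A * ((2 : ℝ) ^ 8 * v ^ (4 + 4 * δ)) := by
          have a : (2 : ℝ) ^ (4 + 4 * δ) * Real.exp A ≤ 2 ^ 8 * Real.exp A :=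
            mul_le_mul_of_nonneg_right h2pow hexp0
          exact mul_le_mul a hApow (Real.rpow_nonneg hA0 _) (by positivity)
      _ = (2 : ℝ) ^ 16 * (Real.exp A * v ^ (3 / 2 : ℝ)) * v ^ (5 / 2 + 4 * δ) := by
          rw [hsplit]; ring
      _ ≤ (2 : ℝ) ^ 16 * (8 * Real.exp c₀ * s) * v ^ (5 / 2 + 4 * δ) := by
          have := mul_le_mul_of_nonneg_left hexpA' (show (0 : ℝ) ≤ 2 ^ 16 by norm_num)
          exact mul_le_mul_of_nonneg_right this (hvpos _).le
      _ = (2 : ℝ) ^ 19 * Real.exp c₀ * (s * v ^ (5 / 2 + 4 * δ)) := by ring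
      _ ≤ v ^ (2 * δ) / 2 * (s * v ^ (5 / 2 + 4 * δ)) := by
          refine mul_le_mul_of_nonneg_right ?_ (by positivity)
          have := h.c2
          rw [← hu, ← hv] at this
          have e : (2 : ℝ) ^ 20 * Real.exp (D₂₀ + (D + 2) * δ⁻¹ ^ 2) = 2 * ((2 : ℝ) ^ 19 * Real.exp c₀) := by
            rw [hc₀]; ring
          linarith
      _ = lam (5 / 2 + 6 * δ) N / 2 := by
          rw [hΛ, ← hsplit']; ring
  -- (f9) the low term `≤ Λ/2`
  have hlow : blockExp δ (D + 2) A' (2 * ℓ₂ ^ 2 + 2) ≤ lam (5 / 2 + 6 * δ) N / 2 := by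
    have hV16 : (16 : ℝ) ≤ 2 * ℓ₂ ^ 2 + 2 := by
      have : (4 : ℝ) ^ 2 ≤ ℓ₂ ^ 2 := pow_le_pow_left₀ (by norm_num) hℓ4 2
      linarith
    have hV4 : 2 * ℓ₂ ^ 2 + 2 ≤ 4 * v ^ 2 := by
      have a : ℓ₂ ^ 2 ≤ v ^ 2 := pow_le_pow_left₀ hℓ₂0.le hℓ₂v 2
      have b : (1 : ℝ) ≤ v ^ 2 := one_le_pow₀ hv1
      linarith
    have hD2 : 0 ≤ D + 2 := by linarith
    refine (blockExp_mono hδ0 hD2 hA'0 hV16 hV4).trans ?_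
    unfold blockExp
    -- `log log(4v²) ≤ 2v`
    have hlv : Real.log v ≤ v - 1 := Real.log_le_sub_one_of_pos hv0
    have hl4 : Real.log 4 < 2 := by
      have : Real.log 4 = 2 * Real.log 2 := by
        rw [show (4 : ℝ) = 2 ^ 2 by norm_num, Real.log_pow]; norm_num
      have := Real.log_two_lt_d9; linarith
    have hlog4v : Real.log (4 * v ^ 2) ≤ 2 * v := by
      rw [Real.log_mul (by norm_num) (by positivity), Real.log_pow]; push_cast; linarith
    have hlog4v0 : 1 < Real.log (4 * v ^ 2) := by
      rw [Real.log_mul (by norm_num) (by positivity), Real.log_pow]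
      have : 1 < Real.log 4 := by
        rw [← Real.log_exp 1]; refine Real.log_lt_log (Real.exp_pos 1) ?_
        have := Real.exp_one_lt_d9; linarith
      have : 0 ≤ Real.log v := Real.log_nonneg hv1
      push_cast; linarith
    have hLL : Real.log (Real.log (4 * v ^ 2)) ≤ 2 * v := by
      have a : Real.log (Real.log (4 * v ^ 2)) ≤ Real.log (2 * v) :=
        Real.log_le_log (by linarith only [hlog4v0]) hlog4v
      have b : Real.log (2 * v) ≤ 2 * v - 1 := Real.log_le_sub_one_of_pos (by linarith only [hv0])
      linarith only [a, b]
    have hLL0 : 0 ≤ Real.log (Real.log (4 * v ^ 2)) := Real.log_nonneg hlog4v0.le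
    have hc1' : (D + 2) * δ⁻¹ ^ 2 ≤ v := by
      have h1 := h.c1; rw [← hu, ← hv] at h1
      have h2 : 0 ≤ Real.log v := Real.log_nonneg hv1
      linarith only [h1, h2, abs_nonneg D₂₀]
    -- each term
    have hv2 : (0 : ℝ) ≤ 4 * v ^ 2 := by positivity
    have t1 : 4 * v ^ 2 * A' ≤ 4 * v ^ 3 := by
      have h1 := mul_le_mul_of_nonneg_left hA'v hv2
      have e : 4 * v ^ 2 * v = 4 * v ^ 3 := by ring
      linarith only [h1, e]
    have t2 : 2 * (1 + δ) * (4 * v ^ 2) * Real.log (Real.log (4 * v ^ 2)) ≤ 32 * v ^ 3 := by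
      have a : 2 * (1 + δ) * (4 * v ^ 2) ≤ 16 * v ^ 2 := by
        have h4 : 2 * (1 + δ) ≤ 4 := by linarith only [hδ1]
        have h5 := mul_le_mul_of_nonneg_right h4 hv2
        linarith only [h5]
      calc 2 * (1 + δ) * (4 * v ^ 2) * Real.log (Real.log (4 * v ^ 2))
          ≤ 16 * v ^ 2 * (2 * v) := mul_le_mul a hLL hLL0 (by positivity)
        _ = 32 * v ^ 3 := by ring
    have t3 : (D + 2) * (4 * v ^ 2) * δ⁻¹ ^ 2 ≤ 4 * v ^ 3 := by
      have h1 := mul_le_mul_of_nonneg_right hc1' hv2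
      have e : (D + 2) * (4 * v ^ 2) * δ⁻¹ ^ 2 = (D + 2) * δ⁻¹ ^ 2 * (4 * v ^ 2) := by ring
      have e' : v * (4 * v ^ 2) = 4 * v ^ 3 := by ring
      linarith only [h1, e, e']
    have hs80 : 80 * v ^ 3 ≤ s := by
      have h1 := h.c3; rw [← hu, ← hv, ← hs] at h1
      have h2 : 0 ≤ v ^ 3 := by positivity
      linarith only [h1, h2]
    have hv56 : 1 ≤ v ^ (5 / 2 + 6 * δ) := Real.one_le_rpow hv1 (by positivity)
    have h40 : 40 * v ^ 3 ≤ lam (5 / 2 + 6 * δ) N / 2 := by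
      rw [hΛ]
      have h1 := mul_le_mul hs80 hv56 zero_le_one hs0.le
      linarith only [h1]
    linarith only [t1, t2, t3, h40]
  -- (f10) the count factor
  have hcnt : logB / ℓ₂ + 1 ≤ u := by
    have h1 : logB / ℓ₂ ≤ logB / 4 := div_le_div_of_nonneg_left hlogB0.le (by norm_num) hℓ4
    linarith only [h1, hlogB_hi, hu22]
  -- assemble
  have hE0 : 0 < Real.exp (lam (5 / 2 + 6 * δ) N / 2) := Real.exp_pos _
  calc Real.exp (blockExp δ (D + 2) A' (2 * ℓ₂ ^ 2 + 2)) +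
        2 * C * (logB / ℓ₂ + 1) * Real.exp ((2 : ℝ) ^ (4 + 4 * δ) * Real.exp A * A ^ (4 + 4 * δ))
      ≤ Real.exp (lam (5 / 2 + 6 * δ) N / 2) +
        2 * C * u * Real.exp (lam (5 / 2 + 6 * δ) N / 2) := by
        refine add_le_add (Real.exp_le_exp.2 hlow) ?_
        exact mul_le_mul (mul_le_mul_of_nonneg_left hcnt (by positivity)) (Real.exp_le_exp.2 hΦ)
          (Real.exp_pos _).le (by positivity)
    _ = (1 + 2 * C * u) * Real.exp (lam (5 / 2 + 6 * δ) N / 2) := by ring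

/-- The size threshold is passed on every dyadic block `2^k`, `k ≥ κ`. [folklore] -/
lemma thr_le_two_pow (h : LargeN δ D C D₂₀ Ca M tthr N) {k : ℕ} (hk : kap N ≤ k) :
    tthr ≤ ((2 ^ k : ℕ) : ℝ) := by
  have h1 : tthr ≤ yPar N := h.ythr
  have h2 : yPar N < kap N + 1 := Nat.lt_floor_add_one _
  have h3 : kap N + 1 ≤ 2 ^ kap N := Nat.lt_two_pow_self
  have h4 : 2 ^ kap N ≤ 2 ^ k := Nat.pow_le_pow_right two_pos hk
  have h5 : ((kap N : ℝ) + 1) ≤ ((2 ^ k : ℕ) : ℝ) := by exact_mod_cast h3.trans h4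
  linarith

/-- **The far sum** (Balazard–de Roton 2008, Prop. 24 with `c = 5/2`): under `LargeN`,
`Σ_{N₀ ≤ n < T} e^{E_n}/(n+1) ≤ exp((log N)^{1/2}(log log N)^{5/2+6δ})`.
[cite: BalazardRoton2008, Prop. 24] -/
theorem far_sum_le {T₁ T₁₈ T₂₀ : ℝ} (hδ0 : 0 < δ) (hδ1 : δ ≤ 1) (hD : 0 ≤ D)
    (h18 : Prop18With δ T₁₈) (h20 : Prop20With δ C D₂₀ T₂₀) (hC : 0 ≤ C)
    (h : LargeN δ D C D₂₀ Ca M tthr N)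
    (hthr : ∀ t : ℝ, tthr ≤ t → GoodSize T₁ T₁₈ t ∧ GoodCount δ D₂₀ T₂₀ t) :
    ∑ n ∈ Finset.Ico (nzero N) (bigT N),
        Real.exp (blockE δ (max D 0 + 2) (Real.log ((N : ℝ) + 1 / 2)) n) / ((n : ℝ) + 1) ≤
      Real.exp (lam (5 / 2 + 6 * δ) N) := by
  obtain ⟨hu22, hκ1, hκK, hκy, hyκ, hKu, hKl, hTN, hNT, hN0⟩ := params h
  set u := Real.log N with hu
  rw [nzero, bigT, sum_Ico_two_pow _ hκK.le]
  have hblock : ∀ k ∈ Finset.Ico (kap N) (bigK N),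
      ∑ n ∈ Finset.Ico (2 ^ k) (2 ^ (k + 1)),
        Real.exp (blockE δ (max D 0 + 2) (Real.log ((N : ℝ) + 1 / 2)) n) / ((n : ℝ) + 1) ≤
        (1 + 2 * C * u) * Real.exp (lam (5 / 2 + 6 * δ) N / 2) := by
    intro k hk
    rw [Finset.mem_Ico] at hk
    obtain ⟨hg, hgc⟩ := hthr _ (thr_le_two_pow h hk.1)
    have hkx : ((2 ^ (k + 1) : ℕ) : ℝ) ≤ (N : ℝ) + 1 / 2 := by
      have h1 : 2 ^ (k + 1) ≤ 2 ^ bigK N := Nat.pow_le_pow_right two_pos hk.2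
      have h2 : ((2 ^ (k + 1) : ℕ) : ℝ) ≤ N := by exact_mod_cast h1.trans hTN
      linarith
    refine (block_sum_le hδ0 hδ1 hD h18 h20 hC hg hgc hkx).trans ?_
    exact bracket_le hδ0 hδ1 hD hC h hk.1 hk.2 hgc.2.1 hgc.2.2.2
  refine (Finset.sum_le_sum hblock).trans ?_
  rw [Finset.sum_const, Nat.card_Ico, nsmul_eq_mul]
  -- `(K − κ)(1 + 2Cu) e^{Λ/2} ≤ 2u(1+2Cu)e^{Λ/2} ≤ e^{Λ}`
  have hlog2 := Real.log_two_gt_d9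
  have hK2u : ((bigK N - kap N : ℕ) : ℝ) ≤ 2 * u := by
    have h1 : ((bigK N - kap N : ℕ) : ℝ) ≤ bigK N := by exact_mod_cast Nat.sub_le _ _
    nlinarith
  have hE0 : 0 < Real.exp (lam (5 / 2 + 6 * δ) N / 2) := Real.exp_pos _
  have hCu : 0 ≤ 1 + 2 * C * u := by positivity
  have hc4 : 2 * u * (1 + 2 * C * u) ≤ Real.exp (u ^ (1 / 2 : ℝ) / 2) := h.c4
  have hsΛ : u ^ (1 / 2 : ℝ) ≤ lam (5 / 2 + 6 * δ) N := by
    have hv1 : 1 ≤ Real.log u := by have := h.v6; linarith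
    exact le_mul_of_one_le_right (Real.rpow_nonneg (by linarith) _)
      (Real.one_le_rpow hv1 (by positivity))
  calc ((bigK N - kap N : ℕ) : ℝ) * ((1 + 2 * C * u) * Real.exp (lam (5 / 2 + 6 * δ) N / 2))
      ≤ 2 * u * ((1 + 2 * C * u) * Real.exp (lam (5 / 2 + 6 * δ) N / 2)) :=
        mul_le_mul_of_nonneg_right hK2u (by positivity)
    _ = (2 * u * (1 + 2 * C * u)) * Real.exp (lam (5 / 2 + 6 * δ) N / 2) := by ring
    _ ≤ Real.exp (u ^ (1 / 2 : ℝ) / 2) * Real.exp (lam (5 / 2 + 6 * δ) N / 2) :=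
        mul_le_mul_of_nonneg_right hc4 hE0.le
    _ ≤ Real.exp (lam (5 / 2 + 6 * δ) N / 2) * Real.exp (lam (5 / 2 + 6 * δ) N / 2) :=
        mul_le_mul_of_nonneg_right (Real.exp_le_exp.2 (by linarith)) hE0.le
    _ = Real.exp (lam (5 / 2 + 6 * δ) N) := by rw [← Real.exp_add]; ring_nf

/-- **The first segment's term**: under `LargeN`, `16 N₀ Z_m ≤ exp((log N)^{1/2}(log log N)^{5/2+6δ})`
("`≪ N^{1/2} T_κ³`" in §8.3). [cite: BalazardRoton2008, §8.3] -/
theorem mid_term_le (hδ0 : 0 < δ) (hδ1 : δ ≤ 1) (hD : 0 ≤ D) (hCa : 0 ≤ Ca)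
    (h : LargeN δ D C D₂₀ Ca M tthr N) :
    16 * (nzero N : ℝ) * (Ca * Real.log ((N : ℝ) + 1 / 2) ^ M +
        Real.exp (Real.log (nzero N : ℝ) / Real.log (Real.log (nzero N : ℝ)) *
          (Real.log (Real.log ((N : ℝ) + 1 / 2)) + 2 * (1 + δ) * Real.log (Real.log (Real.log (nzero N : ℝ))) +
            D * δ⁻¹ ^ 2))) ≤ Real.exp (lam (5 / 2 + 6 * δ) N) := by
  obtain ⟨hu22, hκ1, hκK, hκy, hyκ, hKu, hKl, hTN, hNT, hN0⟩ := params h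
  set u := Real.log N with hu
  set v := Real.log u with hv
  set s := u ^ (1 / 2 : ℝ) with hs
  set y := yPar N with hy
  set L := Real.log ((N : ℝ) + 1 / 2) with hL
  have hlog2 := Real.log_two_gt_d9
  have hlog2' := Real.log_two_lt_d9
  have hu0 : 0 < u := by linarith
  have hv6 : 6 ≤ v := h.v6
  have hv0 : 0 < v := by linarith
  have hv1 : 1 ≤ v := by linarith
  have hs0 : 0 < s := Real.rpow_pos_of_pos hu0 _
  have hy2 : 2 ≤ y := h.y2
  have hy0 : 0 ≤ y := by linarith
  have hyeq : y = s * v ^ (5 / 2 : ℝ) := rfl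
  have hv52 : 1 ≤ v ^ (5 / 2 : ℝ) := Real.one_le_rpow hv1 (by norm_num)
  have hsy : s ≤ y := by rw [hyeq]; exact le_mul_of_one_le_right hs0.le hv52
  -- `N₀ = 2^κ`, `log N₀ = κ log 2 ∈ [y/4, y]`
  have hN₀ : (nzero N : ℝ) = 2 ^ kap N := by rw [nzero]; push_cast; ring
  have hlogN₀ : Real.log (nzero N : ℝ) = kap N * Real.log 2 := by rw [hN₀, Real.log_pow]
  have hlogN₀y : Real.log (nzero N : ℝ) ≤ y := by
    rw [hlogN₀]
    have : (kap N : ℝ) * Real.log 2 ≤ kap N * 1 :=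
      mul_le_mul_of_nonneg_left (by linarith) (Nat.cast_nonneg _)
    linarith
  have hlogN₀lo : y / 4 ≤ Real.log (nzero N : ℝ) := by rw [hlogN₀]; exact hyκ
  have hlogN₀0 : 0 < Real.log (nzero N : ℝ) := by linarith
  -- `log y ≥ v/2`, hence `L₂ N₀ ≥ v/4`
  have hlogy : v / 2 ≤ Real.log y := by
    rw [hyeq, Real.log_mul hs0.ne' (ne_of_gt (Real.rpow_pos_of_pos hv0 _)), hs,
      Real.log_rpow hu0, Real.log_rpow hv0, ← hv]
    have : 0 ≤ Real.log v := Real.log_nonneg hv1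
    linarith
  have hl4 : Real.log 4 < 1.4 := by
    have : Real.log 4 = 2 * Real.log 2 := by
      rw [show (4 : ℝ) = 2 ^ 2 by norm_num, Real.log_pow]; norm_num
    linarith
  have hL₂N₀ : v / 4 ≤ Real.log (Real.log (nzero N : ℝ)) := by
    have h1 : Real.log (y / 4) ≤ Real.log (Real.log (nzero N : ℝ)) :=
      Real.log_le_log (by linarith) hlogN₀lo
    rw [Real.log_div (by linarith) (by norm_num)] at h1
    linarith
  have hL₂N₀0 : 0 < Real.log (Real.log (nzero N : ℝ)) := by linarith
  -- `L₂ N₀ ≤ v` and `0 ≤ L₃ N₀ ≤ v`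
  have hyu : y ≤ u := by have := h.yu; linarith
  have hL₂N₀v : Real.log (Real.log (nzero N : ℝ)) ≤ v := by
    rw [hv]; exact Real.log_le_log hlogN₀0 (hlogN₀y.trans hyu)
  have hL₃N₀ : Real.log (Real.log (Real.log (nzero N : ℝ))) ≤ v := by
    have h1 : Real.log (Real.log (Real.log (nzero N : ℝ))) ≤ Real.log v :=
      Real.log_le_log hL₂N₀0 hL₂N₀v
    have h2 : Real.log v ≤ v - 1 := Real.log_le_sub_one_of_pos hv0
    linarith
  have hL₃N₀0 : 0 ≤ Real.log (Real.log (Real.log (nzero N : ℝ))) := Real.log_nonneg (by linarith)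
  -- `L ≤ 2u`, `log L ≤ 2v`
  obtain ⟨hLu, hLu1⟩ := log_x_bounds (N := N) (by
    have : Real.log (N : ℝ) ≤ (N : ℝ) - 1 := Real.log_le_sub_one_of_pos hN0
    linarith)
  have hL2u : L ≤ 2 * u := by rw [hL]; linarith
  have hL0 : 0 < L := by rw [hL]; linarith
  have hlogL : Real.log L ≤ 2 * v := by
    have h1 : Real.log L ≤ Real.log (2 * u) := Real.log_le_log hL0 hL2u
    rw [Real.log_mul two_ne_zero hu0.ne', ← hv] at h1
    linarith
  have hlogL0 : 0 ≤ Real.log L := Real.log_nonneg (by rw [hL]; linarith)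
  -- the bracket `≤ 7v` and the exponent `≤ 28 y`
  have hDv : D * δ⁻¹ ^ 2 ≤ v := by
    have h1 := h.c1; rw [← hu, ← hv] at h1
    have h2 : 0 ≤ Real.log v := Real.log_nonneg hv1
    have h3 : D * δ⁻¹ ^ 2 ≤ (D + 2) * δ⁻¹ ^ 2 :=
      mul_le_mul_of_nonneg_right (by linarith) (sq_nonneg _)
    linarith only [h1, h2, h3, abs_nonneg D₂₀]
  set br := Real.log L + 2 * (1 + δ) * Real.log (Real.log (Real.log (nzero N : ℝ))) + D * δ⁻¹ ^ 2
    with hbr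
  have hbr7 : br ≤ 7 * v := by
    have h1 : 2 * (1 + δ) * Real.log (Real.log (Real.log (nzero N : ℝ))) ≤ 4 * v := by
      have a : 2 * (1 + δ) ≤ 4 := by linarith
      exact (mul_le_mul a hL₃N₀ hL₃N₀0 (by norm_num))
    rw [hbr]; linarith only [h1, hlogL, hDv]
  have hbr0 : 0 ≤ br := by rw [hbr]; positivity
  have hexpo : Real.log (nzero N : ℝ) / Real.log (Real.log (nzero N : ℝ)) * br ≤ 28 * y := by
    have h1 : Real.log (nzero N : ℝ) / Real.log (Real.log (nzero N : ℝ)) ≤ y / (v / 4) :=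
      div_le_div₀ hy0 hlogN₀y (by linarith) hL₂N₀
    have h2 := mul_le_mul h1 hbr7 hbr0 (by positivity)
    have e : y / (v / 4) * (7 * v) = 28 * y := by field_simp; ring
    linarith only [h2, e]
  -- `Ca L^M ≤ e^y`, `N₀ ≤ e^y`
  have hCaL : Ca * L ^ M ≤ Real.exp y := by
    have h1 : L ^ M ≤ (2 * u) ^ M := pow_le_pow_left₀ hL0.le hL2u M
    have h2 : Ca * L ^ M ≤ Ca * (2 * u) ^ M := mul_le_mul_of_nonneg_left h1 hCa
    have h3 : Ca * (2 * u) ^ M ≤ Real.exp s := h.c5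
    have h4 : Real.exp s ≤ Real.exp y := Real.exp_le_exp.2 hsy
    linarith only [h2, h3, h4]
  have hN₀e : (nzero N : ℝ) ≤ Real.exp y := by
    rw [hN₀]
    have he : (2 : ℝ) ≤ Real.exp 1 := by have := Real.exp_one_gt_d9; linarith
    calc (2 : ℝ) ^ kap N ≤ Real.exp 1 ^ kap N := pow_le_pow_left₀ (by norm_num) he _
      _ = Real.exp (kap N) := by rw [← Real.exp_one_pow]
      _ ≤ Real.exp y := Real.exp_le_exp.2 hκy
  -- `Λ = y v^{6δ} ≥ 33 y`
  have hΛ : lam (5 / 2 + 6 * δ) N = y * v ^ (6 * δ) := by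
    show s * v ^ (5 / 2 + 6 * δ) = s * v ^ (5 / 2 : ℝ) * v ^ (6 * δ)
    rw [Real.rpow_add hv0]; ring
  have hΛ33 : 33 * y ≤ lam (5 / 2 + 6 * δ) N := by
    rw [hΛ]; have := h.c6; rw [← hu, ← hv] at this
    nlinarith only [this, hy0]
  -- conclude
  have hey : 0 < Real.exp y := Real.exp_pos y
  have h28 : Real.exp (Real.log (nzero N : ℝ) / Real.log (Real.log (nzero N : ℝ)) * br) ≤ Real.exp (28 * y) :=
    Real.exp_le_exp.2 hexpo
  have hy28 : Real.exp y ≤ Real.exp (28 * y) := Real.exp_le_exp.2 (by linarith)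
  have h32 : (32 : ℝ) ≤ Real.exp (4 * y) := by
    have h1 : (4 : ℝ) * 2 ≤ 4 * y := by linarith
    have h2 : Real.exp 8 ≤ Real.exp (4 * y) := Real.exp_le_exp.2 (by linarith)
    have h3 : (32 : ℝ) ≤ Real.exp 8 := by
      have he : (2 : ℝ) ≤ Real.exp 1 := by have := Real.exp_one_gt_d9; linarith
      have h4 : (2 : ℝ) ^ 8 ≤ Real.exp 1 ^ 8 := pow_le_pow_left₀ (by norm_num) he 8
      rw [Real.exp_one_pow] at h4
      norm_num at h4
      exact le_trans (by norm_num) h4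
    linarith
  calc 16 * (nzero N : ℝ) * (Ca * L ^ M + Real.exp (Real.log (nzero N : ℝ) / Real.log (Real.log (nzero N : ℝ)) * br))
      ≤ 16 * Real.exp y * (Real.exp y + Real.exp (28 * y)) := by
        refine mul_le_mul (mul_le_mul_of_nonneg_left hN₀e (by norm_num)) (add_le_add hCaL h28)
          (by positivity) (by positivity)
    _ ≤ 16 * Real.exp y * (2 * Real.exp (28 * y)) := by
        refine mul_le_mul_of_nonneg_left ?_ (by positivity); linarith
    _ = 32 * (Real.exp y * Real.exp (28 * y)) := by ring
    _ ≤ Real.exp (4 * y) * (Real.exp y * Real.exp (28 * y)) :=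
        mul_le_mul_of_nonneg_right h32 (by positivity)
    _ = Real.exp (33 * y) := by rw [← Real.exp_add, ← Real.exp_add]; ring_nf
    _ ≤ Real.exp (lam (5 / 2 + 6 * δ) N) := Real.exp_le_exp.2 hΛ33

/-- The block base of `T − 1` is `T/2 = 2^{K−1}`. [folklore] -/
lemma bbase_bigT_sub_one {N : ℕ} (hK : 1 ≤ bigK N) : bbase (bigT N - 1) = 2 ^ (bigK N - 1) := by
  rw [bbase, bigT]
  congr 1
  apply Nat.log_eq_of_pow_le_of_lt_pow
  · have : 2 ^ (bigK N - 1 + 1) = 2 ^ bigK N := by rw [Nat.sub_add_cancel hK]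
    have h2 : 2 ^ (bigK N - 1) + 2 ^ (bigK N - 1) = 2 ^ bigK N := by rw [← two_mul, ← pow_succ', Nat.sub_add_cancel hK]
    have h3 : 1 ≤ 2 ^ (bigK N - 1) := Nat.one_le_two_pow
    omega
  · rw [Nat.sub_add_cancel hK]
    exact Nat.sub_lt Nat.one_le_two_pow Nat.one_pos

/-- **The end connectors' term**: under `LargeN` (and the size thresholds), 
`32 (e^{E_{T−1}} + e^{D V_{T−1} δ⁻¹}) ≤ √(N + ½)` ("`≪_δ N^{1/2}`" in §8.3). [cite: BalazardRoton2008, §8.3] -/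
theorem end_term_le {T₁ T₁₈ T₂₀ : ℝ} (hδ0 : 0 < δ) (hδ1 : δ ≤ 1) (hD : 0 ≤ D)
    (h18 : Prop18With δ T₁₈) (h : LargeN δ D C D₂₀ Ca M tthr N)
    (hthr : ∀ t : ℝ, tthr ≤ t → GoodSize T₁ T₁₈ t ∧ GoodCount δ D₂₀ T₂₀ t) :
    32 * (Real.exp (blockE δ (max D 0 + 2) (Real.log ((N : ℝ) + 1 / 2)) (bigT N - 1)) +
        Real.exp (D * (lad δ (bigT N - 1)) * δ⁻¹)) ≤ Real.sqrt ((N : ℝ) + 1 / 2) := by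
  obtain ⟨hu22, hκ1, hκK, hκy, hyκ, hKu, hKl, hTN, hNT, hN0⟩ := params h
  set u := Real.log N with hu
  set v := Real.log u with hv
  set L := Real.log ((N : ℝ) + 1 / 2) with hL
  have hmax : max D 0 = D := max_eq_left hD
  have hlog2 := Real.log_two_gt_d9
  have hlog2' := Real.log_two_lt_d9
  have hu0 : 0 < u := by linarith
  have hv6 : 6 ≤ v := h.v6
  have hv0 : 0 < v := by linarith
  have hv1 : 1 ≤ v := by linarith
  have hK1 : 1 ≤ bigK N := by omega
  -- the block of `T − 1`
  have hB : bbase (bigT N - 1) = 2 ^ (bigK N - 1) := bbase_bigT_sub_one hK1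
  have hthrB : tthr ≤ ((2 ^ (bigK N - 1) : ℕ) : ℝ) := thr_le_two_pow h (by omega)
  obtain ⟨hg, hgc⟩ := hthr _ hthrB
  have hb1 : bbase (bigT N - 1) ≤ bigT N - 1 := by
    rw [hB, bigT]
    have : 2 ^ (bigK N - 1) < 2 ^ bigK N := Nat.pow_lt_pow_right one_lt_two (by omega)
    omega
  have hb2 : bigT N - 1 + 1 ≤ 2 * bbase (bigT N - 1) := by
    rw [hB, bigT, ← pow_succ', Nat.sub_add_cancel hK1, Nat.sub_add_cancel Nat.one_le_two_pow]
  rw [← hB] at hg hgc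
  obtain ⟨hadm, h4, hup, hlogB, -⟩ := lad_facts h18 hg hb1 hb2
  obtain ⟨hℓ2, hℓT, hB0, hB1', hB7⟩ := size_facts hg.2.2.1
  set B : ℝ := (bbase (bigT N - 1) : ℝ) with hBdef
  set V : ℝ := (lad δ (bigT N - 1) : ℝ) with hV
  have hℓ4 : 4 ≤ Real.log (Real.log B) := hgc.2.1
  -- `log B ≥ u − 2 ≥ u/2`, `log B ≤ u`, `L₂ B ≥ v/2`
  have hlogBeq : Real.log B = ((bigK N : ℝ) - 1) * Real.log 2 := by
    rw [hBdef, hB]; push_cast; rw [Real.log_pow, Nat.cast_sub hK1]; push_cast; ring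
  have hlogB_lo : u / 2 ≤ Real.log B := by rw [hlogBeq]; linarith only [hKl, hu22]
  have hlogB_hi : Real.log B ≤ u := by
    rw [hlogBeq]
    have e : ((bigK N : ℝ) - 1) * Real.log 2 = (bigK N : ℝ) * Real.log 2 - Real.log 2 := by ring
    linarith only [e, hKu, hlog2]
  have hlogB0 : 0 < Real.log B := by linarith only [hlogB_lo, hu22]
  have hL₂B : v / 2 ≤ Real.log (Real.log B) := by
    have h1 : Real.log (u / 2) ≤ Real.log (Real.log B) :=
      Real.log_le_log (by linarith only [hu22]) hlogB_lo
    rw [Real.log_div hu0.ne' two_ne_zero, ← hv] at h1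
    linarith only [h1, hlog2', hv6]
  have hL₂B0 : 0 < Real.log (Real.log B) := by linarith only [hL₂B, hv6]
  -- `V ≤ 2u/v`, `16 ≤ V`
  have hV16 : 16 ≤ V := by
    have : (4 : ℝ) ^ 2 ≤ Real.log (Real.log B) ^ 2 := pow_le_pow_left₀ (by norm_num) hℓ4 2
    have h2 := hadm.1
    rw [← hV] at h2
    linarith only [this, h2]
  have hV0 : 0 ≤ V := by linarith only [hV16]
  have hVu : V ≤ 2 * u / v := by
    calc V ≤ Real.log B / Real.log (Real.log B) := hup
      _ ≤ u / (v / 2) := div_le_div₀ hu0.le hlogB_hi (by linarith only [hv6]) hL₂B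
      _ = 2 * u / v := by field_simp
  -- `L ≤ 2u`, `A'' ≤ log 4`
  obtain ⟨hLu, hLu1⟩ := log_x_bounds (N := N) (by
    have : Real.log (N : ℝ) ≤ (N : ℝ) - 1 := Real.log_le_sub_one_of_pos hN0
    linarith only [this, hu22])
  have hL2u : L ≤ 2 * u := by rw [hL]; linarith only [hLu1, hu22]
  have hLlogB : Real.log B ≤ L := by rw [hL]; linarith only [hlogB_hi, hLu]
  have hA0 : 0 ≤ Real.log (L / Real.log B) := Real.log_nonneg ((one_le_div hlogB0).2 hLlogB)
  have hA4 : Real.log (L / Real.log B) ≤ Real.log 4 := by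
    refine Real.log_le_log (div_pos (by linarith only [hlogB0, hLlogB]) hlogB0) ?_
    rw [div_le_iff₀ hlogB0]; linarith only [hL2u, hlogB_lo]
  -- `E ≤ u/16`
  have hlogv : Real.log 6 ≤ Real.log v := Real.log_le_log (by norm_num) hv6
  have hlog6 : 1 < Real.log 6 := by
    rw [← Real.log_exp 1]; refine Real.log_lt_log (Real.exp_pos 1) ?_
    have := Real.exp_one_lt_d9; linarith
  have hlogv0 : 0 < Real.log v := by linarith only [hlogv, hlog6]
  have hE : blockExp δ (D + 2) (Real.log (L / Real.log B)) V ≤ u / 16 := by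
    have h2uv : V ≤ 2 * u / v := hVu
    have hD2 : 0 ≤ D + 2 := by linarith
    refine (blockExp_mono hδ0 hD2 hA0 hV16 h2uv).trans ?_
    unfold blockExp
    have hW0 : 0 < 2 * u / v := by positivity
    -- `log log(2u/v) ≤ 2 log v`
    have hW1 : 2 < 2 * u / v := by
      rw [lt_div_iff₀ hv0]
      have : v ≤ u - 1 := by rw [hv]; exact Real.log_le_sub_one_of_pos hu0
      linarith only [this, hu22]
    have hlW : Real.log (2 * u / v) ≤ Real.log (2 * u) :=
      Real.log_le_log hW0 (div_le_self (by positivity) hv1)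
    have hlW0 : 0 < Real.log (2 * u / v) := Real.log_pos (by linarith only [hW1])
    have hl2u : Real.log (2 * u) = Real.log 2 + v := by rw [Real.log_mul two_ne_zero hu0.ne', ← hv]
    have hLLW : Real.log (Real.log (2 * u / v)) ≤ 2 * Real.log v := by
      have a : Real.log (Real.log (2 * u / v)) ≤ Real.log (Real.log 2 + v) := by
        rw [← hl2u]; exact Real.log_le_log hlW0 hlW
      have b : Real.log (Real.log 2 + v) ≤ Real.log (2 * v) :=
        Real.log_le_log (by linarith only [hlog2, hv0]) (by linarith only [hlog2', hv6])
      rw [Real.log_mul two_ne_zero hv0.ne'] at b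
      have c : Real.log 2 ≤ Real.log v := by linarith only [hlogv, hlog6, hlog2']
      linarith only [a, b, c]
    have hc7 : Real.log 4 + (D + 2) * δ⁻¹ ^ 2 ≤ 2 * Real.log v := by
      have := h.c7; rw [← hu, ← hv] at this; exact this
    have hc8 : 320 * Real.log v ≤ v := by have := h.c8; rw [← hu, ← hv] at this; exact this
    set W := 2 * u / v with hW
    have hlv0 : 0 ≤ Real.log v := hlogv0.le
    have t1 : W * Real.log (L / Real.log B) ≤ W * Real.log 4 := mul_le_mul_of_nonneg_left hA4 hW0.le
    have t2 : 2 * (1 + δ) * W * Real.log (Real.log W) ≤ 8 * (W * Real.log v) := by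
      have b : 0 ≤ W * Real.log v := by positivity
      rcases le_or_gt (Real.log (Real.log W)) 0 with hneg | hpos
      · have h0 : 2 * (1 + δ) * W * Real.log (Real.log W) ≤ 0 := by
          have : 0 ≤ 2 * (1 + δ) * W := by positivity
          exact mul_nonpos_of_nonneg_of_nonpos this hneg
        linarith only [h0, b]
      · have a : W * Real.log (Real.log W) ≤ W * (2 * Real.log v) := mul_le_mul_of_nonneg_left hLLW hW0.le
        have c : 2 * (1 + δ) * (W * Real.log (Real.log W)) ≤ 4 * (W * Real.log (Real.log W)) :=
          mul_le_mul_of_nonneg_right (by linarith only [hδ1]) (by positivity)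
        calc 2 * (1 + δ) * W * Real.log (Real.log W) = 2 * (1 + δ) * (W * Real.log (Real.log W)) := by ring
          _ ≤ 4 * (W * Real.log (Real.log W)) := c
          _ ≤ 4 * (W * (2 * Real.log v)) := by linarith only [a]
          _ = 8 * (W * Real.log v) := by ring
    have t3 : (D + 2) * W * δ⁻¹ ^ 2 = W * ((D + 2) * δ⁻¹ ^ 2) := by ring
    have hsum : W * Real.log (L / Real.log B) + 2 * (1 + δ) * W * Real.log (Real.log W) +
        (D + 2) * W * δ⁻¹ ^ 2 ≤ 10 * (W * Real.log v) := by
      have a : W * Real.log 4 + W * ((D + 2) * δ⁻¹ ^ 2) ≤ W * (2 * Real.log v) := by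
        rw [← mul_add]; exact mul_le_mul_of_nonneg_left hc7 hW0.le
      linarith only [t1, t2, t3, a]
    have hfin : 10 * (W * Real.log v) ≤ u / 16 := by
      rw [hW]
      have e : 10 * (2 * u / v * Real.log v) = u / 16 * (320 * Real.log v / v) := by
        field_simp; ring
      rw [e]
      have : 320 * Real.log v / v ≤ 1 := by rw [div_le_one hv0]; exact hc8
      have hu16 : 0 ≤ u / 16 := by positivity
      exact mul_le_of_le_one_right hu16 this
    linarith only [hsum, hfin]
  -- `D V δ⁻¹ ≤ u/16`
  have hDV : D * V * δ⁻¹ ≤ u / 16 := by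
    have hc9 : 32 * D * δ⁻¹ ≤ v := by have := h.c9; rw [← hu, ← hv] at this; exact this
    have hDδ : 0 ≤ D * δ⁻¹ := by positivity
    calc D * V * δ⁻¹ = D * δ⁻¹ * V := by ring
      _ ≤ D * δ⁻¹ * (2 * u / v) := mul_le_mul_of_nonneg_left hVu hDδ
      _ = u / 16 * (32 * D * δ⁻¹ / v) := by field_simp; ring
      _ ≤ u / 16 * 1 := by
          refine mul_le_mul_of_nonneg_left ?_ (by positivity)
          rw [div_le_one hv0]; exact hc9
      _ = u / 16 := mul_one _
  -- conclude: `64 e^{u/16} ≤ e^{u/2} = √N ≤ √(N + ½)`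
  rw [show blockE δ (max D 0 + 2) L (bigT N - 1) =
      blockExp δ (max D 0 + 2) (Real.log (L / Real.log B)) V from rfl, hmax]
  have h64 : (64 : ℝ) ≤ Real.exp (7 * u / 16) := by
    have he : (2 : ℝ) ≤ Real.exp 1 := by have := Real.exp_one_gt_d9; linarith
    have h1 : (2 : ℝ) ^ 6 ≤ Real.exp 1 ^ 6 := pow_le_pow_left₀ (by norm_num) he 6
    rw [Real.exp_one_pow] at h1
    norm_num at h1
    have h2 : Real.exp 6 ≤ Real.exp (7 * u / 16) := Real.exp_le_exp.2 (by linarith only [hu22])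
    exact h1.trans h2
  have hsqrt : Real.exp (u / 2) ≤ Real.sqrt ((N : ℝ) + 1 / 2) := by
    have h1 : Real.exp (u / 2) = Real.sqrt N := by
      rw [Real.sqrt_eq_rpow, Real.rpow_def_of_pos hN0, hu]; ring_nf
    rw [h1]; exact Real.sqrt_le_sqrt (by linarith)
  calc 32 * (Real.exp (blockExp δ (D + 2) (Real.log (L / Real.log B)) V) + Real.exp (D * V * δ⁻¹))
      ≤ 32 * (Real.exp (u / 16) + Real.exp (u / 16)) := by
        refine mul_le_mul_of_nonneg_left (add_le_add (Real.exp_le_exp.2 hE) (Real.exp_le_exp.2 hDV))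
          (by norm_num)
    _ = 64 * Real.exp (u / 16) := by ring
    _ ≤ Real.exp (7 * u / 16) * Real.exp (u / 16) :=
        mul_le_mul_of_nonneg_right h64 (Real.exp_pos _).le
    _ = Real.exp (u / 2) := by rw [← Real.exp_add]; ring_nf
    _ ≤ Real.sqrt ((N : ℝ) + 1 / 2) := hsqrt

/-- **The Perron integral over Soundararajan's contour, for `N` large** (Balazard–de Roton 2008
Prop. 22 / 2010 (t46)–(t47) before the near-ordinate analysis): under RH, Props. 1, 18 and the
numeric conditions `LargeN`, for `c = 1 + 1/log x`, `x = N + ½`, `|τ| ≤ T/4`,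
`‖∫_{-T}^{T} ζ(c+iu)⁻¹ x^{c+iu}/(c+iu−iτ) du‖ ≤ √x (24 S(τ) + exp Λ) + √x`, with
`S(τ) = Σ_{N₀ ≤ n < T} e^{E_n}(1/(1+|n−τ|) + 1/(1+|n+τ|))`, `Λ = (log N)^{1/2}(log log N)^{5/2+6δ}`.
[cite: BalazardRoton2008, Prop. 22; BalazardDeRoton2010, §6.2] -/
theorem perron_integral_le_of_largeN (hRH : RiemannHypothesis) {T₁ T₁₈ T₂₀ t₀ : ℝ}
    (hδ0 : 0 < δ) (hδ1 : δ ≤ 1) (hD : 0 ≤ D) (hP1 : Prop1With δ D T₁) (h18 : Prop18With δ T₁₈)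
    (h : LargeN δ D C D₂₀ Ca M tthr N)
    (hthr : ∀ t : ℝ, tthr ≤ t → GoodSize T₁ T₁₈ t ∧ GoodCount δ D₂₀ T₂₀ t) (hCa : 0 ≤ Ca)
    (hsmall : ∀ σ t : ℝ, 1 / 2 < σ → σ < 1 → |t| ≤ t₀ →
      ‖(riemannZeta (σ + t * I))⁻¹‖ ≤ Ca * (σ - 1 / 2) ^ (-(M : ℝ)))
    (hmid : ∀ t : ℝ, t₀ < t → MidGood T₁ T₁₈ t) {c : ℝ} (hc : c = 1 + 1 / Real.log ((N : ℝ) + 1 / 2))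
    {τ : ℝ} (hτ : |τ| ≤ (bigT N : ℝ) / 4) :
    ‖∫ u in (-(bigT N : ℝ))..(bigT N : ℝ), (riemannZeta (c + u * I))⁻¹ *
        ((((N : ℝ) + 1 / 2 : ℝ) : ℂ) ^ ((c : ℂ) + u * I) / ((c : ℂ) + u * I - τ * I))‖ ≤
      Real.sqrt ((N : ℝ) + 1 / 2) *
          (24 * ∑ n ∈ Finset.Ico (nzero N) (bigT N),
              Real.exp (blockE δ (max D 0 + 2) (Real.log ((N : ℝ) + 1 / 2)) n) *
                (1 / (1 + |(n : ℝ) - τ|) + 1 / (1 + |(n : ℝ) + τ|)) +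
            Real.exp (lam (5 / 2 + 6 * δ) N)) +
        Real.sqrt ((N : ℝ) + 1 / 2) := by
  obtain ⟨hu22, hκ1, hκK, hκy, hyκ, hKu, hKl, hTN, hNT, hN0⟩ := params h
  have hTx : ((bigT N : ℕ) : ℝ) ≤ (N : ℝ) + 1 / 2 := by
    have : ((bigT N : ℕ) : ℝ) ≤ N := by exact_mod_cast hTN
    linarith
  have hxT : (N : ℝ) + 1 / 2 ≤ 4 * ((bigT N : ℕ) : ℝ) := by
    have : (N : ℝ) + 1 ≤ 2 * ((bigT N : ℕ) : ℝ) := by exact_mod_cast hNT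
    linarith
  have hL4 : 4 ≤ Real.log ((N : ℝ) + 1 / 2) := by
    have : Real.log (N : ℝ) ≤ Real.log ((N : ℝ) + 1 / 2) := Real.log_le_log hN0 (by linarith)
    linarith
  have hN₀thr : tthr ≤ ((nzero N : ℕ) : ℝ) := thr_le_two_pow h le_rfl
  have hgood : ∀ t : ℝ, ((nzero N : ℕ) : ℝ) ≤ t → t ≤ (N : ℝ) + 1 / 2 → GoodSize T₁ T₁₈ t :=
    fun t ht _ ↦ (hthr t (hN₀thr.trans ht)).1
  have hmain := norm_perron_integral_le (τ := τ) hRH hδ0 hδ1 hD hP1 h18 (rfl : nzero N = 2 ^ kap N)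
    (rfl : bigT N = 2 ^ bigK N) hκ1 hκK hTx hxT hL4 hgood hCa hsmall (fun t ht _ ↦ hmid t ht) hc hτ
  have hmid' := mid_term_le hδ0 hδ1 hD hCa h
  have hend := end_term_le hδ0 hδ1 hD h18 h (T₂₀ := T₂₀) hthr
  have hsx : 0 ≤ Real.sqrt ((N : ℝ) + 1 / 2) := Real.sqrt_nonneg _
  have hS0 : 0 ≤ 24 * ∑ n ∈ Finset.Ico (nzero N) (bigT N),
      Real.exp (blockE δ (max D 0 + 2) (Real.log ((N : ℝ) + 1 / 2)) n) *
        (1 / (1 + |(n : ℝ) - τ|) + 1 / (1 + |(n : ℝ) + τ|)) := by positivity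
  nlinarith [mul_le_mul_of_nonneg_left hmid' hsx]

end eval

end SoundContour

end Literature.NumberTheory.LFunctions

end
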